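/-
Copyright (c) 2026 the pub-hodgecm-mathlib formalisation cell (harness21).  Prover seat hodgecm-mathlib-R90-C10-p03 (g2), SLAB R90-TF, section S1 «Ch. 10∕12 local»;
crux H413 = `stmt-HodgeConjecture-24833`; line «B_pos» RAMIFIED TAME corner (B-10), card (8⁺c) (dealer R90-C10-plan (g3) ruling R-S1-33 (1), 2026-09-05T02:50:17Z):
«THE UNLETTERED (S-RT) PAYER» — ★ (8⁺b)'s tame head with its two shell letters `HRa` ∕ `HRb` discharged BY NAME ((a′)-R ∕ (6d-Rb)), every auxiliary choice made
inside; the ONE name K2E3's organ edition consumes for the (S-RT) socket (JUNCTION RULE: one name per socket).  KERNEL module: THEOREMS ONLY (no definition, no named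
fact, no `sorry`, no instance, no notation).  2026-09-05.
-/
import Summits.HodgeConjecture.HodgeConjecture.Theorems.R90S1KeysThmTwoPosDepthBranchBRamifiedTameLeafOfRecord  -- (8⁺b) (R90-C10-p05 (g2)): `exists_eta_of_reducible_posDepth_normTrivial_ramifiedTame (HRa) (HRb)` (the (S-RT) head modulo the two shell letters); brings ★ (8), ★ (8⁺a)
import Summits.HodgeConjecture.HodgeConjecture.Theorems.R90S1BposRamShellsVanishOfRecord                   -- (a′)-R (R90-C10-p08 (g2)): `shellsVanish_of_fixTrivial` (the (R-a) letter `HRa` over the (6e) frame letters); brings ★ (a′)-1∕-2, ★ (G4), ★ (6e), ★ (B)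
import Summits.HodgeConjecture.HodgeConjecture.Theorems.R90S1BposRamShellLawRb                            -- (6d-Rb) (this seat): `shellLaw_of_record` (the (R-b) letter `HRb`, no letters left); brings ★ (6d-R), ★ (6d), (6a-G) FILE 3, ★ P1 §0′
import HarnessLib

/-!
# R90-TF S1 «Ch10-local» ∕ K2 E3 «U4Keys» :182, BRANCH B AT POSITIVE DEPTH, TAMELY RAMIFIED PLACE — card (8⁺c): THE (S-RT) PAYER, UNLETTERED
# `i(χ₁, 1)` reducible, `χ₁` continuous non-unitary contracting of positive depth with `χ₁(u·σu) = 1` on units, `v` non-split ramified with `|2|_{w′} = 1`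
# ⟹ `χ₁ = η·‖·‖^{1∕2}` for a continuous quadratic character extension `η` [Keys1984 §3, §7 Thm (2) (b)–(d); Casselman1980 §3; Roche1998 §3–§4; Rogawski1990 §12.2]

Cell `pub/hodgecm-mathlib`, crux H413 = `stmt-HodgeConjecture-24833`, route of record `HCCMUnconditional` (no route verbs); R90-TF section S1 (base R90-C10), dealer
R90-C10-plan (g3) (rulings R-S1-27 «four layers», R-S1-30∕33 «(S-RT) endgame», R-S1-31 «★-only imports»), line lead R90-C10-p05 (g2), auditor R90-C10-audit1 (g3),
junction keepers R90-C10-typ1 (g5) ∕ typ2 (g4) (seam S-d: binder list ≡ organ ED. 11 (S-RT) socket modulo `Or.inr`).  THEOREMS ONLY; lane `--supports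
stmt-HodgeConjecture-24833 --as helper`, count-neutral.  THIS FILE IS THE (S-RT) PAYER BY NAME — the mirror of ★ p864624 `exists_eta_of_reducible_posDepth_normTrivial_inertAll`
((S-I)) — but (S-RT) ∕ :182 CLOSE ONLY when K2E3's organ `K2_E3_EllipticInputsSigs_U4Keys` edition `exact Or.inr (…ramifiedTameAll …)` is WRITTEN AND BUILT (HONEST LABEL).

THE POINT.  ★-to-be (8⁺b) `exists_eta_of_reducible_posDepth_normTrivial_ramifiedTame (hns hrf h2 χ₁ h₁ hnu hcontr _hram hpos hB) (HRa) (HRb) (hred)` (R90-C10-p05 (g2)) is the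
tame head modulo two ∀-closed SHELL LETTERS over the (8⁺a) frame `(w hw) (_he _h2w) {ϖ} (_hϖ) (piU _hpiU) {m ν} (_hm _hνν) (_hcond) (u₁ _hu₁ _hχu₁) [Borel N] (μ) [IsHaarMeasure]`:
`HRa` ((R-a): `χ₁ = 1` on the σ-fixed units of valuation one ⟹ every cut shell of `F₀` vanishes) and `HRb` ((R-b): a σ-fixed unit of valuation one with `χ₁ ≠ 1` ⟹ even
shells `0`, odd shells `C·X^{κ+1}`, `C²·X = (q^ν·μ B(ν,0))²·((q−1)²·(q^{2ν+1})⁻¹)`).  BOTH are now theorems: `HRb` = (6d-Rb) `R90S1BposRamShellLawRb.shellLaw_of_record` (this seat,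
over ★ (6d-R) ∘ (6a-G) FILE 3) and `HRa` = (a′)-R `R90S1BposRamShellsVanishOfRecord.shellsVanish_of_fixTrivial` (R90-C10-p08 (g2), over ★ (a′)-1∕-2, ★ (G4), ★ (6e)) at the
auxiliary choices made HERE: `borel R`, `μ_R := addHaar`, `μ⁻ := addHaar`, `Invertible 2`, `c := ½` (`σ½ + ½ = 1`, `σ½ = ½`, `|½|_w = 1` — ★ `HeisRing.map_invOf_two`,
`invOf_two_add_invOf_two`, ★ `valued_invOf_two_apply`), `l := σΠ·Π` (★ (6b) P1 §0′ `scalingUnit_letters_conj_mul_ram`).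
* §1 **`exists_eta_of_reducible_posDepth_normTrivial_ramifiedTameAll (hns) (hrf) (h2) (χ₁) (h₁) (hnu) (hcontr) (_hram) (hpos) (hB) (hred)`** ⊢ **`∃ η, IsQuadraticCharExtension σ η ∧
  Continuous η ∧ χ₁ = η * halfModulusChar (LocalRing L v)`** — binder list = organ ED. 11 (S-RT) socket `sig_K2E3KeysThmTwoContractingRamifiedCharOnePosDepthNormTrivialRamifiedTame`
  :224–:238 VERBATIM (the `LocalRing` spelling of ★ p864624), conclusion = its DISJUNCT 2; ONE term: (8⁺b) fed `HRa := by intro …; exact shellsVanish_of_fixTrivial …` and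
  `HRb := by intro …; exact shellLaw_of_record …`.
HONEST LABEL.  HC_CM is proved only modulo the 7 printed citations (2 remaining named inputs: hLiu418 = `stmt-HodgeConjecture-24832`, h413 = `stmt-HodgeConjecture-24833`) until
rung 0 closes; count-neutral — this file is the (S-RT) payer BY NAME; :182 is REL over {(S-I) ★ p864624, (S-RT) this, (S-W) UNSTAFFED (wild `v ∣ 2` ramified, XL)} and closes
in the organ only when its editions are WRITTEN + BUILT; A2′ ∕ C :88∕:98 OPEN; no printed citation is discharged; REL ≠ ★ ≠ WRITTEN ≠ BUILT; no closing by fiat.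

## References
* [Keys1984] D. Keys, *Principal series representations of special unitary groups over local fields*, Compositio Math. 51 (1984), §3, §7 Theorem (2) (b)–(d) p. 126.
* [Casselman1980] W. Casselman, *The unramified principal series of p-adic groups I*, Compositio Math. 40 (1980), §3.
* [Roche1998] A. Roche, *Types and Hecke algebras for principal series representations of split reductive p-adic groups*, Ann. Sci. ÉNS (4) 31 (1998), §3–§4.
* [Rogawski1990] J. D. Rogawski, *Automorphic Representations of Unitary Groups in Three Variables*, Ann. of Math. Stud. 123 (1990), §12.2 (1)–(2) p. 173.
-/

set_option autoImplicit false
set_option linter.dupNamespace false  -- the mandated namespace has the single-problem summit's repeated segment (`HodgeConjecture.HodgeConjecture`)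

noncomputable section

open NumberField IsDedekindDomain MeasureTheory Measure Literature.NumberTheory Literature.NumberTheory.Automorphic Literature.NumberTheory.Automorphic.UnitaryGroup
open scoped Matrix MatrixGroups WithZero Valued NNReal ENNReal

namespace Summit.HodgeConjecture.HodgeConjecture.R90.S1

open Summit.HodgeConjecture.HodgeConjecture.Cruxes.H413

variable (L : Type) [Field L] [NumberField L] [IsCMField L] (v : HeightOneSpectrum (𝓞 ↥(maximalRealSubfield L)))

/-! ## §1 The (S-RT) payer: ★ (8⁺b) fed `HRa := (a′)-R`, `HRb := (6d-Rb)` -/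

open scoped Classical in
set_option maxHeartbeats 4000000 in
set_option synthInstance.maxHeartbeats 400000 in
-- the two shell letters' `F₀`-dites and GL-coercion chains on the matrix-group carrier of `N(L⁺_v)` (class of ★ (8) §2 ∕ (8⁺b))
/-- **U4Keys :182 IN BRANCH B AT POSITIVE DEPTH, TAMELY RAMIFIED PLACE — THE (S-RT) PAYER, UNLETTERED.**  `v` non-split (`hns`) and RAMIFIED in `L` (`hrf`), TAME (`h2`:
`|2|_{w′} = 1` at every `w′ ∣ v`); `χ₁ : (L ⊗ L⁺_v)ˣ → ℂˣ` continuous (`h₁`), non-unitary (`hnu`), contracting (`hcontr`), ramified (`_hram`, idle — kept for the socket's binder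
list), of positive depth (`hpos`), with `χ₁(u·σu) = 1` on the units of valuation one (`hB`, Branch B).  If `i(χ₁, 1)` is reducible (`hred`) then **`χ₁ = η·‖·‖^{1∕2}` for a
continuous quadratic character extension `η` of `σ`** — DISJUNCT 2 of the (S-RT) socket `sig_K2E3KeysThmTwoContractingRamifiedCharOnePosDepthNormTrivialRamifiedTame` of the organ
`K2_E3_EllipticInputsSigs_U4Keys` (binders VERBATIM).  Keys' Theorem §7 (2) (b)–(d) at a tame ramified place: Branch B forces an even conductor `n = 2ν` and Roche's group `J_e`,
`e = (ν, 0; ν, 1)`; the Casselman pair on the normalised `(J_e, θ)`-plane has `det = 0` (reducibility), its entries are the (R-a) zeros (absurd: `det = −q^{−n}V₁V₂ ≠ 0`) or the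
(R-b) Γ-shapes `V·ΓX∕(1−X)`, `Γ²X = (q−1)²q^{−n−1}` (the quadratic Gauss sum), whose only admissible root is `X = χ₁(σΠ·Π) = q⁻¹ = ‖σΠ·Π‖^{1∕2}`, i.e. `χ₁ = η·‖·‖^{1∕2}`.
One term: ★-to-be (8⁺b) `exists_eta_of_reducible_posDepth_normTrivial_ramifiedTame` with `HRa :=` (a′)-R `shellsVanish_of_fixTrivial` (at `borel R`, `addHaar`², `½`, `σΠ·Π`) and
`HRb :=` (6d-Rb) `shellLaw_of_record`. [cite: Keys1984, §3, §7 Theorem (2) (b)–(d) p. 126] [cite: Casselman1980, §3] [cite: Roche1998, §3–§4] [cite: Rogawski1990, §12.2 (1)–(2) p. 173] -/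
theorem exists_eta_of_reducible_posDepth_normTrivial_ramifiedTameAll
    (hns : ∀ w' : PlacesOver L v, IsCMField.complexConj L • w'.1 = w'.1)
    (hrf : ¬ Algebra.IsUnramifiedIn (𝓞 L) v.asIdeal)
    (h2 : ∀ w' : PlacesOver L v, Valued.v (2 : w'.1.adicCompletion L) = 1)
    (χ₁ : (LocalRing L v)ˣ →* ℂˣ) (h₁ : Continuous fun x => ((χ₁ x : ℂˣ) : ℂ)) (hnu : ∃ x, ‖((χ₁ x : ℂˣ) : ℂ)‖ ≠ 1)
    (hcontr : ∀ x : (LocalRing L v)ˣ, unitModulusChar (LocalRing L v) x < 1 → ‖((χ₁ x : ℂˣ) : ℂ)‖ < 1)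
    (_hram : ¬ (∀ u ∈ (Submonoid.pi Set.univ (fun w : PlacesOver L v => (w.1.adicCompletionIntegers L).toSubring.toSubmonoid)).units, χ₁ u = 1))
    (hpos : ∃ u : (LocalRing L v)ˣ, (∀ w' : PlacesOver L v, Valued.v (((u : LocalRing L v) w') - 1) < 1) ∧ χ₁ u ≠ 1)
    (hB : ∀ u : (LocalRing L v)ˣ, (∀ w' : PlacesOver L v, Valued.v ((u : LocalRing L v) w') = 1) →
      χ₁ (u * Units.map (conjLocal L (IsCMField.complexConj L) v : LocalRing L v →* LocalRing L v) u) = 1)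
    (hred : ∃ N : Subrepresentation (cmPrincipalSeries L 3 v (cmTorusCharPair L v χ₁ 1)), N ≠ ⊥ ∧ N ≠ ⊤) :
    ∃ η : (LocalRing L v)ˣ →* ℂˣ, IsQuadraticCharExtension (conjLocal L (IsCMField.complexConj L) v) η ∧
      Continuous (fun x => ((η x : ℂˣ) : ℂ)) ∧ χ₁ = η * halfModulusChar (LocalRing L v) := by
  refine exists_eta_of_reducible_posDepth_normTrivial_ramifiedTame L v hns hrf h2 χ₁ h₁ hnu hcontr _hram hpos hB ?_ ?_ hred
  · -- `HRa` := (a′)-R at the auxiliary choices `borel R`, `μ_R := addHaar`, `μ⁻ := addHaar`, `c := ½`, `l := σΠ·Π`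
    intro w hw he h2w ϖ hϖ piU hpiU m ν hm hνν hcond u₁ hu₁ hχu₁ _ _ μ _ hRa0
    haveI : SecondCountableTopology (LocalRing L v) := secondCountableTopology_localRing (E := L) v
    letI : MeasurableSpace (LocalRing L v) := borel _
    haveI : BorelSpace (LocalRing L v) := ⟨rfl⟩
    letI : Invertible (2 : LocalRing L v) := (isUnit_two_localRing L v).invertible
    have hσc := continuous_conjLocal L (IsCMField.complexConj L) v
    haveI := HeisRing.locallyCompactSpace_skewPart (conjLocal L (IsCMField.complexConj L) v) hσc
    haveI : SecondCountableTopology ↥(HeisRing.skewPart (conjLocal L (IsCMField.complexConj L) v)) := TopologicalSpace.Subtype.secondCountableTopology _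
    obtain ⟨μX, hμX⟩ : ∃ μ' : Measure (LocalRing L v), μ' = Measure.addHaar := ⟨_, rfl⟩
    haveI : μX.IsAddHaarMeasure := by rw [hμX]; infer_instance
    haveI : μX.Regular := by rw [hμX]; infer_instance
    obtain ⟨μY, hμY⟩ : ∃ μ' : Measure ↥(HeisRing.skewPart (conjLocal L (IsCMField.complexConj L) v)), μ' = Measure.addHaar := ⟨_, rfl⟩
    haveI : μY.IsAddHaarMeasure := by rw [hμY]; infer_instance
    haveI : μY.Regular := by rw [hμY]; infer_instance
    have hcσ : conjLocal L (IsCMField.complexConj L) v (⅟ (2 : LocalRing L v)) = ⅟ (2 : LocalRing L v) := HeisRing.map_invOf_two _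
    have hc : conjLocal L (IsCMField.complexConj L) v (⅟ (2 : LocalRing L v)) + ⅟ (2 : LocalRing L v) = 1 := by rw [hcσ, invOf_two_add_invOf_two]
    have hcw : Valued.v ((⅟ (2 : LocalRing L v)) w) = 1 := valued_invOf_two_apply L v w h2w
    obtain ⟨hlσ, hlv, hlm⟩ := BposRamShellFibres.scalingUnit_letters_conj_mul_ram L v w hw he piU hpiU
    exact BposRamShellsVanishOfRecord.shellsVanish_of_fixTrivial L v w hw hns he h2w χ₁ h₁ hcontr μX μY μ hϖ hc hcw.le hνν hcσ hcw hm hcond u₁ hu₁ hχu₁ _ hlσ hlv hlm hRa0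
  · -- `HRb` := (6d-Rb)
    intro w hw he h2w ϖ hϖ piU hpiU m ν hm hνν hcond u₁ hu₁ hχu₁ _ _ μ _ hFε
    exact BposRamShellLawRb.shellLaw_of_record L v w hw hns he h2w hϖ χ₁ h₁ hcontr hB piU hpiU hm hνν hcond u₁ hu₁ hχu₁ μ hFε

end Summit.HodgeConjecture.HodgeConjecture.R90.S1

end
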